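import Mathlib
import HarnessLib

/-!
# QUANT lane R8, front "FAR beyond trees", layer one — THE DEGREE-THREE GATE AT THE OBSERVER, LXXIVa: the CORNER LINE of cell (9,9) —
# CLOSED-FORM regime `c' (coupled-plus)` of the chart-D system

builds on p205010 (kernel theorem, internal audit signed; external expert review pending)

Support file (`--supports stmt-CriticalPhenomena-4575`), seat `prim-quant-p1` (gen 37); memo
`run/shared/lean/prim/quant/prim-quant-p1-g37/FOR-LEAD-GATE3-CORNERLINE.md`.  Mathlib-only real algebra on the chart-D system of file LV
(`Gate3.chartC_of_chartD` / `Gate3.red8_of_chartD`); standard axioms; no sorries; no definitions.  GENERATED by `work/gen_kernel.py` (p1 g37).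

THE POINT.  The last open patch of the degree-three gate below `p = 1/20` is the cell `r₁, r₂ ∈ [9/10, 1)` below `nn·p = 5/8`, whose box
certificates (charts C, D, Db of p1 g32–g34) fail exactly at the corner line `ε = 1 − r₁ → 0, u = 1/nn → 0` and at the triple corner `σ = nn·p → 0`
(g34 memo §4/§8, g36 memo §6): the degree-2 polynomial multipliers blow up like `1/ε`.  Dividing by `ε`, `σ`, `B₁`, `B₂` is harmless in a
closed-form proof, and four elementary chains of the chart-D inequalities (real algebra, with the non-polynomial steps `(1−κ)D < Y` from
`g_v`, the `B₂`-free / `B₁`-free combinations of `g₁, g₂`, Harris rows `U1, U2, K1, K2`, the form `g_S` and the mean row `E`) cover the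
whole cell (four files LXXIVa–d, cover in LXXV):
* `chartD_cp` — `Δ' ≤ κ·c₀'` (contains the coupled regime `Δ' ≤ 0`): `U2 ∘ (g₁,g₂) ∘ g_v` bound the observer cells by `φ·Y`, contradiction with `g₁,g₂`;
* `chartD_a`  — the CORNER-LINE regime (`ε(1+θ) ≲ 3σ`): the same bound `Y < Ψ·B₁` fed into `K1` against `g_S`;
* `chartD_b`  — the SMALL-σ regime (`ε(1+θ) ≳ 3σ/2`, `u` small): the mean row `E` bounds `Y`, then `K1 + K2` against `g_S`;
* `chartD_d`  — the MANY-RELAYS regime (`u ≳ ε`): `E` bounds `Y`, `U1, U2` bound `u·Bᵢ` by `φ·Y`, and the two bounds multiply to a contradiction.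
Here `κ = σu`, `Y = a0 + c0`, `Δ' = (1−κ)² − (1−(1−κ)ε)(1−(1−κ)θε)`, `c₀', c₀''` the `a0`-coefficients of the two `g`-combinations; the regime
hypotheses are explicit polynomial inequalities in `(σ, u, ε, θ)` and free bound parameters (`Ψ`, `c̄`, `s̄`, `Ȳ`), supplied by the cover file.
[cite: KozmaNitzan2024, Conjecture 3 (p. 15)]; [this work].
-/

noncomputable section

namespace Summit.CriticalPhenomena.PercolationContinuityZ3.Theorems

namespace Quant

namespace Gate3

set_option maxHeartbeats 4000000 in
/-- **Regime c' (coupled-plus)**: if `Δ' ≤ σu·c₀'` the chart-D system is infeasible (`0 < σ`, `σu ≤ 1/10`, `0 < ε ≤ 1/10`, `0 < θ ≤ 1`;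
contains the coupled regime `Δ' ≤ 0`). [this work] -/
theorem chartD_cp (σ u ε θ : ℝ) (hσ : 0 < σ) (hu : 0 < u) (hκ : σ * u ≤ 1 / 10) (hε : 0 < ε) (hε1 : ε ≤ 1 / 10) (hθ : 0 < θ) (hθ1 : θ ≤ 1)
    (hcp : ((1 - σ * u) ^ 2 - (1 - (1 - σ * u) * ε) * (1 - (1 - σ * u) * (θ * ε))) ≤ σ * u * ((1 - σ * u) * (1 - θ * ε) + (1 - (1 - σ * u) * (θ * ε)) * (1 - ε))) :
    ∀ (a0 a1 At B1 B2 c0 c1 D : ℝ), 0 ≤ a0 → 0 ≤ a1 → 0 ≤ At → 0 ≤ B1 → 0 ≤ B2 → 0 ≤ c0 → 0 ≤ c1 → 0 ≤ D →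
      0 ≤ (σ * D * (a0 + a1 + σ * u * (ε * θ * At)) - B1 * (u * B2 + (c0 + c1))) →
      0 ≤ (σ * D * (a0 + a1 + σ * u * (ε * θ * At)) - B2 * (u * B1 + (c0 + c1))) →
      0 ≤ (σ * D * (a0 + a1 + σ * u * (ε * θ * At)) - (c0 + c1) * (B1 + B2)) →
      0 ≤ (σ * D * (a0 + u * B1 + u * B2 + c0) - B1 * (a1 + σ * u * (ε * θ * At) + c1 + σ * u * D)) →
      0 ≤ (σ * D * (a0 + u * B1 + u * B2 + c0) - B2 * (a1 + σ * u * (ε * θ * At) + c1 + σ * u * D)) →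
      0 ≤ ((c1 + σ * u * D) * (a0 + u * B1 + u * B2 + c0) - c0 * (a1 + σ * u * (ε * θ * At) + c1 + σ * u * D)) →
      0 < ε * a0 + (-(1 - σ * u)) * At + ε * c0 + (-((1 - σ * u) * ε)) * D →
      0 < (-(σ * (1 - θ * ε))) * a0 + (-σ) * a1 + (-(σ * θ * (1 - σ * u * (1 - ε)))) * At + (1 - σ * u) * B1 + (-(1 - (1 - σ * u) * (θ * ε))) * B2 + (-(σ * ε * θ)) * c1 →
      0 < (-(σ * (1 - ε))) * a0 + (-σ) * a1 + (-(σ * (1 - σ * u * (1 - θ * ε)))) * At + (-(1 - (1 - σ * u) * ε)) * B1 + (1 - σ * u) * B2 + (-(σ * ε)) * c1 →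
      0 < (-(σ * (1 - ε) * (θ * ε))) * a0 + (1 - σ * u * (1 - θ * ε) - σ * θ * ε) * a1 + (-((σ * u + (1 - σ * u) * (1 - ε)) * (θ * ε))) * B1 + (-((σ * u + (1 - σ * u) * (1 - θ * ε)) * ε)) * B2 + (1 - σ * u * (1 - ε * ε * θ) - σ * (ε * ε * θ)) * c1 →
      0 < (σ * u * (3 - ε - θ * ε) + σ * (1 - θ * ε) - 2) * a0 + (σ * u * (2 - ε) + σ * (1 - θ * ε) - 1) * a1 + (ε * θ * (σ * (σ * u * u * (3 - ε - θ * ε) + 1 - 2 * u))) * At + ((σ * u + (1 - σ * u) * (1 - ε)) * (1 - θ * ε) * (1 + u) - (1 - σ * u) * ε * u) * B1 + ((σ * u + (1 - σ * u) * (1 - θ * ε)) * (1 - ε) * (1 + u) - (1 - σ * u) * (θ * ε) * u) * B2 + (σ * u + (σ + 2 * (σ * u)) * (1 - ε * ε * θ) - 2) * c0 + (σ * u + (σ + σ * u) * (1 - ε * ε * θ) - 1) * c1 + (σ + σ * u - σ * u * ((1 - σ * u) * (ε * ε * θ))) * D →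
      False := by
  intro a0 a1 At B1 B2 c0 c1 D ha0 ha1 hAt hB1 hB2 hc0 hc1 hD hU1 hU2 hU3 hK1 hK2 hK3 hV hG1 hG2 hS hE
  -- parameter signs
  have hk0 : 0 ≤ σ * u := (mul_pos hσ hu).le
  have hk : 0 < 1 - σ * u := by linarith only [hκ]
  have hk9 : 9 / 10 ≤ 1 - σ * u := by linarith only [hκ]
  have hk1 : 1 - σ * u ≤ 1 := by linarith only [hk0]
  have hθε0 : 0 < θ * ε := mul_pos hθ hε
  have hθεle : θ * ε ≤ ε := mul_le_of_le_one_left hε.le hθ1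
  have hθε : θ * ε ≤ 1 / 10 := by linarith only [hθεle, hε1]
  have hε9 : 9 / 10 ≤ 1 - ε := by linarith only [hε1]
  have hε1' : 1 - ε ≤ 1 := by linarith only [hε]
  have hε0' : 0 ≤ 1 - ε := by linarith only [hε1]
  have hθε9 : 9 / 10 ≤ 1 - θ * ε := by linarith only [hθε]
  have hθε1 : 0 ≤ 1 - θ * ε := by linarith only [hθε]
  have hθε1' : 1 - θ * ε ≤ 1 := by linarith only [hθε0]
  have hkθε : 0 ≤ σ * u * (θ * ε) := mul_nonneg hk0 hθε0.le
  have hkε : 0 ≤ σ * u * ε := mul_nonneg hk0 hε.le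
  have hg1 : 0 ≤ (1 - σ * u) * (θ * ε) := mul_nonneg hk.le hθε0.le
  have hg2 : 0 ≤ (1 - σ * u) * ε := mul_nonneg hk.le hε.le
  have hsue : 9 / 10 ≤ 1 - σ * u * (1 - ε) := by linarith only [hκ, hkε]
  have hsut : 9 / 10 ≤ 1 - σ * u * (1 - θ * ε) := by linarith only [hκ, hkθε]
  have hsue0 : 0 ≤ 1 - σ * u * (1 - ε) := by linarith only [hsue]
  have hsut0 : 0 ≤ 1 - σ * u * (1 - θ * ε) := by linarith only [hsut]
  have hf19 : 9 / 10 ≤ 1 - (1 - σ * u) * (θ * ε) := by linarith only [hθε, hkθε]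
  have hf29 : 9 / 10 ≤ 1 - (1 - σ * u) * ε := by linarith only [hε1, hkε]
  have hf1 : 0 ≤ 1 - (1 - σ * u) * (θ * ε) := by linarith only [hf19]
  have hf2 : 0 ≤ 1 - (1 - σ * u) * ε := by linarith only [hf29]
  have hf1' : 1 - (1 - σ * u) * (θ * ε) ≤ 1 := by linarith only [hg1]
  have hf2' : 1 - (1 - σ * u) * ε ≤ 1 := by linarith only [hg2]
  -- coefficient bounds
  have m1 := mul_le_mul hk9 hθε9 (by norm_num) hk.le
  have m2 := mul_le_mul hf19 hε9 (by norm_num) hf1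
  have m3 := mul_le_mul hf29 hθε9 (by norm_num) hf2
  have m4 := mul_le_mul hk9 hε9 (by norm_num) hk.le
  have m5 := mul_le_mul hk9 hsut (by norm_num) hk.le
  have m6 := mul_le_mul hf19 hsut (by norm_num) hf1
  have m7 := mul_le_mul hf29 hf19 (by norm_num) hf2
  have n1 := mul_le_mul hk1 hθε1' hθε1 (by norm_num)
  have n2 := mul_le_mul hf1' hε1' hε0' (by norm_num)
  have n3 := mul_le_mul hf2' hθε1' hθε1 (by norm_num)
  have n4 := mul_le_mul hk1 hε1' hε0' (by norm_num)
  have hca0p : 8 / 5 ≤ ((1 - σ * u) * (1 - θ * ε) + (1 - (1 - σ * u) * (θ * ε)) * (1 - ε)) := by linarith only [m1, m2]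
  have hca0pp : 8 / 5 ≤ ((1 - (1 - σ * u) * ε) * (1 - θ * ε) + (1 - σ * u) * (1 - ε)) := by linarith only [m3, m4]
  have hca0p2 : ((1 - σ * u) * (1 - θ * ε) + (1 - (1 - σ * u) * (θ * ε)) * (1 - ε)) ≤ 2 := by linarith only [n1, n2]
  have hca0pp2 : ((1 - (1 - σ * u) * ε) * (1 - θ * ε) + (1 - σ * u) * (1 - ε)) ≤ 2 := by linarith only [n3, n4]
  have hca0p0 : 0 < ((1 - σ * u) * (1 - θ * ε) + (1 - (1 - σ * u) * (θ * ε)) * (1 - ε)) := by linarith only [hca0p]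
  have hca0pp0 : 0 < ((1 - (1 - σ * u) * ε) * (1 - θ * ε) + (1 - σ * u) * (1 - ε)) := by linarith only [hca0pp]
  have hca1p0 : 0 ≤ ((1 - σ * u) + (1 - (1 - σ * u) * (θ * ε))) := by linarith only [hk, hf1]
  have hca1pos : 0 < ((1 - σ * u) + (1 - (1 - σ * u) * (θ * ε))) := by linarith only [hk9, hf19]
  have hda10 : 0 ≤ ((1 - σ * u) + (1 - (1 - σ * u) * (θ * ε))) - ((1 - σ * u) * (1 - θ * ε) + (1 - (1 - σ * u) * (θ * ε)) * (1 - ε)) := by linarith only [mul_nonneg hf1 hε.le, hg1]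
  have hda20 : 0 ≤ ((1 - (1 - σ * u) * ε) + (1 - σ * u)) - ((1 - (1 - σ * u) * ε) * (1 - θ * ε) + (1 - σ * u) * (1 - ε)) := by linarith only [mul_nonneg hf2 hθε0.le, hg2]
  have hcAtp : 81 / 100 ≤ ((1 - σ * u) * (θ * (1 - σ * u * (1 - ε))) + (1 - (1 - σ * u) * (θ * ε)) * (1 - σ * u * (1 - θ * ε))) := by
    have q1 : 0 ≤ (1 - σ * u) * (θ * (1 - σ * u * (1 - ε))) := mul_nonneg hk.le (mul_nonneg hθ.le hsue0)
    linarith only [q1, m6]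
  have hcAtpp : 81 / 100 ≤ ((1 - (1 - σ * u) * ε) * (θ * (1 - σ * u * (1 - ε))) + (1 - σ * u) * (1 - σ * u * (1 - θ * ε))) := by
    have q1 : 0 ≤ (1 - (1 - σ * u) * ε) * (θ * (1 - σ * u * (1 - ε))) := mul_nonneg hf2 (mul_nonneg hθ.le hsue0)
    linarith only [q1, m5]
  have hcAtp0 : 0 ≤ ((1 - σ * u) * (θ * (1 - σ * u * (1 - ε))) + (1 - (1 - σ * u) * (θ * ε)) * (1 - σ * u * (1 - θ * ε))) := by linarith only [hcAtp]
  have hcc1p : 0 ≤ ((1 - σ * u) * (ε * θ) + (1 - (1 - σ * u) * (θ * ε)) * ε) := by positivity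
  have hcc1pp : 0 ≤ ((1 - (1 - σ * u) * ε) * (ε * θ) + (1 - σ * u) * ε) := by positivity
  have hke : σ * u * (ε * θ) ≤ 1 / 10 * (1 / 10) :=
    mul_le_mul hκ (by linarith only [hθεle, hε1]) (by positivity) (by norm_num)
  have hke0 : 0 ≤ σ * u * (ε * θ) := by positivity
  have hcmpAt1 : ((1 - σ * u) * (1 - θ * ε) + (1 - (1 - σ * u) * (θ * ε)) * (1 - ε)) * (σ * u * (ε * θ)) ≤ ((1 - σ * u) * (θ * (1 - σ * u * (1 - ε))) + (1 - (1 - σ * u) * (θ * ε)) * (1 - σ * u * (1 - θ * ε))) := by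
    have h := mul_le_mul hca0p2 hke hke0 (by norm_num)
    linarith only [h, hcAtp]
  have hcmpAt2 : ((1 - (1 - σ * u) * ε) * (1 - θ * ε) + (1 - σ * u) * (1 - ε)) * (σ * u * (ε * θ)) ≤ ((1 - (1 - σ * u) * ε) * (θ * (1 - σ * u * (1 - ε))) + (1 - σ * u) * (1 - σ * u * (1 - θ * ε))) := by
    have h := mul_le_mul hca0pp2 hke hke0 (by norm_num)
    linarith only [h, hcAtpp]
  have hs1 : 0 ≤ ((σ * u + (1 - σ * u) * (1 - ε)) * (θ * ε)) := mul_nonneg (add_nonneg hk0 (mul_nonneg hk.le hε0')) hθε0.le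
  have hs2 : 0 ≤ ((σ * u + (1 - σ * u) * (1 - θ * ε)) * ε) := mul_nonneg (add_nonneg hk0 (mul_nonneg hk.le hθε1)) hε.le
  -- Δ' ≤ 1/5 ; W := (1-σu) c₀'' and W₁ := (1-σu) c₀' dominate Δ'
  have hsq : (1 - σ * u) ^ 2 ≤ 1 := by nlinarith only [hk0, hκ]
  have hΔle : ((1 - σ * u) ^ 2 - (1 - (1 - σ * u) * ε) * (1 - (1 - σ * u) * (θ * ε))) ≤ 1 / 5 := by linarith only [m7, hsq]
  have hW : 9 / 10 * (8 / 5) ≤ (1 - σ * u) * ((1 - (1 - σ * u) * ε) * (1 - θ * ε) + (1 - σ * u) * (1 - ε)) := mul_le_mul hk9 hca0pp (by norm_num) hk.le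
  have hW1 : 9 / 10 * (8 / 5) ≤ (1 - σ * u) * ((1 - σ * u) * (1 - θ * ε) + (1 - (1 - σ * u) * (θ * ε)) * (1 - ε)) := mul_le_mul hk9 hca0p (by norm_num) hk.le
  have hWpos : 0 < (1 - σ * u) * ((1 - (1 - σ * u) * ε) * (1 - θ * ε) + (1 - σ * u) * (1 - ε)) := by linarith only [hW]
  have hW1pos : 0 < (1 - σ * u) * ((1 - σ * u) * (1 - θ * ε) + (1 - (1 - σ * u) * (θ * ε)) * (1 - ε)) := by linarith only [hW1]
  have hWΔ : 0 < (1 - σ * u) * ((1 - (1 - σ * u) * ε) * (1 - θ * ε) + (1 - σ * u) * (1 - ε)) - ((1 - σ * u) ^ 2 - (1 - (1 - σ * u) * ε) * (1 - (1 - σ * u) * (θ * ε))) := by linarith only [hW, hΔle]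
  -- B1 > 0, B2 > 0
  have t1 : 0 ≤ σ * (1 - θ * ε) * a0 := mul_nonneg (mul_nonneg hσ.le hθε1) ha0
  have t2 : 0 ≤ σ * a1 := mul_nonneg hσ.le ha1
  have t3 : 0 ≤ σ * θ * (1 - σ * u * (1 - ε)) * At := mul_nonneg (mul_nonneg (mul_nonneg hσ.le hθ.le) hsue0) hAt
  have t4 : 0 ≤ (1 - (1 - σ * u) * (θ * ε)) * B2 := mul_nonneg hf1 hB2
  have t5 : 0 ≤ σ * ε * θ * c1 := by positivity
  have hB1q : 0 < (1 - σ * u) * B1 := by linarith only [hG1, t1, t2, t3, t4, t5]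
  have hB1p : 0 < B1 := (mul_pos_iff_of_pos_left hk).1 hB1q
  have u1 : 0 ≤ σ * (1 - ε) * a0 := mul_nonneg (mul_nonneg hσ.le hε0') ha0
  have u3 : 0 ≤ σ * (1 - σ * u * (1 - θ * ε)) * At := mul_nonneg (mul_nonneg hσ.le hsut0) hAt
  have u4 : 0 ≤ (1 - (1 - σ * u) * ε) * B1 := mul_nonneg hf2 hB1
  have u5 : 0 ≤ σ * ε * c1 := by positivity
  have hB2q : 0 < (1 - σ * u) * B2 := by linarith only [hG2, u1, t2, u3, u4, u5]
  have hB2p : 0 < B2 := (mul_pos_iff_of_pos_left hk).1 hB2q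
  -- ratio bounds from G1, G2
  have hβ1 : (1 - (1 - σ * u) * (θ * ε)) * B2 < (1 - σ * u) * B1 := by linarith only [hG1, t1, t2, t3, t5]
  have hβ2 : (1 - (1 - σ * u) * ε) * B1 < (1 - σ * u) * B2 := by linarith only [hG2, u1, t2, u3, u5]
  -- V: Y := a0 + c0 > 0 and (1 - σu) D < Y
  have v1 : 0 ≤ (1 - σ * u) * At := mul_nonneg hk.le hAt
  have v2 : 0 ≤ (1 - σ * u) * ε * D := mul_nonneg (mul_nonneg hk.le hε.le) hD
  have hYq : 0 < ε * (a0 + c0) := by linarith only [hV, v1, v2]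
  have hY : 0 < a0 + c0 := (mul_pos_iff_of_pos_left hε).1 hYq
  have hDYq : 0 < ε * ((a0 + c0) - (1 - σ * u) * D) := by linarith only [hV, v1]
  have hDY : (1 - σ * u) * D < a0 + c0 := by linarith only [(mul_pos_iff_of_pos_left hε).1 hDYq]
  have hV' : (1 - σ * u) * At + (1 - σ * u) * ε * D < ε * (a0 + c0) := by linarith only [hV]
  -- M1' and M1'' : the B2-free and B1-free combinations of G1, G2
  have eM1 : (1 - σ * u) * ((-(σ * (1 - θ * ε))) * a0 + (-σ) * a1 + (-(σ * θ * (1 - σ * u * (1 - ε)))) * At + (1 - σ * u) * B1 + (-(1 - (1 - σ * u) * (θ * ε))) * B2 + (-(σ * ε * θ)) * c1) + (1 - (1 - σ * u) * (θ * ε)) * ((-(σ * (1 - ε))) * a0 + (-σ) * a1 + (-(σ * (1 - σ * u * (1 - θ * ε)))) * At + (-(1 - (1 - σ * u) * ε)) * B1 + (1 - σ * u) * B2 + (-(σ * ε)) * c1)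
      = ((1 - σ * u) ^ 2 - (1 - (1 - σ * u) * ε) * (1 - (1 - σ * u) * (θ * ε))) * B1 - σ * (((1 - σ * u) * (1 - θ * ε) + (1 - (1 - σ * u) * (θ * ε)) * (1 - ε)) * a0 + ((1 - σ * u) + (1 - (1 - σ * u) * (θ * ε))) * a1 + ((1 - σ * u) * (θ * (1 - σ * u * (1 - ε))) + (1 - (1 - σ * u) * (θ * ε)) * (1 - σ * u * (1 - θ * ε))) * At + ((1 - σ * u) * (ε * θ) + (1 - (1 - σ * u) * (θ * ε)) * ε) * c1) := by ring
  have hM1 : σ * (((1 - σ * u) * (1 - θ * ε) + (1 - (1 - σ * u) * (θ * ε)) * (1 - ε)) * a0 + ((1 - σ * u) + (1 - (1 - σ * u) * (θ * ε))) * a1 + ((1 - σ * u) * (θ * (1 - σ * u * (1 - ε))) + (1 - (1 - σ * u) * (θ * ε)) * (1 - σ * u * (1 - θ * ε))) * At + ((1 - σ * u) * (ε * θ) + (1 - (1 - σ * u) * (θ * ε)) * ε) * c1) < ((1 - σ * u) ^ 2 - (1 - (1 - σ * u) * ε) * (1 - (1 - σ * u) * (θ * ε))) * B1 := by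
    have p1 : 0 < (1 - σ * u) * ((-(σ * (1 - θ * ε))) * a0 + (-σ) * a1 + (-(σ * θ * (1 - σ * u * (1 - ε)))) * At + (1 - σ * u) * B1 + (-(1 - (1 - σ * u) * (θ * ε))) * B2 + (-(σ * ε * θ)) * c1) := mul_pos hk hG1
    have p2 : 0 ≤ (1 - (1 - σ * u) * (θ * ε)) * ((-(σ * (1 - ε))) * a0 + (-σ) * a1 + (-(σ * (1 - σ * u * (1 - θ * ε)))) * At + (-(1 - (1 - σ * u) * ε)) * B1 + (1 - σ * u) * B2 + (-(σ * ε)) * c1) := mul_nonneg hf1 hG2.le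
    linarith only [eM1, p1, p2]
  have eM2 : (1 - (1 - σ * u) * ε) * ((-(σ * (1 - θ * ε))) * a0 + (-σ) * a1 + (-(σ * θ * (1 - σ * u * (1 - ε)))) * At + (1 - σ * u) * B1 + (-(1 - (1 - σ * u) * (θ * ε))) * B2 + (-(σ * ε * θ)) * c1) + (1 - σ * u) * ((-(σ * (1 - ε))) * a0 + (-σ) * a1 + (-(σ * (1 - σ * u * (1 - θ * ε)))) * At + (-(1 - (1 - σ * u) * ε)) * B1 + (1 - σ * u) * B2 + (-(σ * ε)) * c1)
      = ((1 - σ * u) ^ 2 - (1 - (1 - σ * u) * ε) * (1 - (1 - σ * u) * (θ * ε))) * B2 - σ * (((1 - (1 - σ * u) * ε) * (1 - θ * ε) + (1 - σ * u) * (1 - ε)) * a0 + ((1 - (1 - σ * u) * ε) + (1 - σ * u)) * a1 + ((1 - (1 - σ * u) * ε) * (θ * (1 - σ * u * (1 - ε))) + (1 - σ * u) * (1 - σ * u * (1 - θ * ε))) * At + ((1 - (1 - σ * u) * ε) * (ε * θ) + (1 - σ * u) * ε) * c1) := by ring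
  have hM2 : σ * (((1 - (1 - σ * u) * ε) * (1 - θ * ε) + (1 - σ * u) * (1 - ε)) * a0 + ((1 - (1 - σ * u) * ε) + (1 - σ * u)) * a1 + ((1 - (1 - σ * u) * ε) * (θ * (1 - σ * u * (1 - ε))) + (1 - σ * u) * (1 - σ * u * (1 - θ * ε))) * At + ((1 - (1 - σ * u) * ε) * (ε * θ) + (1 - σ * u) * ε) * c1) < ((1 - σ * u) ^ 2 - (1 - (1 - σ * u) * ε) * (1 - (1 - σ * u) * (θ * ε))) * B2 := by
    have p1 : 0 ≤ (1 - (1 - σ * u) * ε) * ((-(σ * (1 - θ * ε))) * a0 + (-σ) * a1 + (-(σ * θ * (1 - σ * u * (1 - ε)))) * At + (1 - σ * u) * B1 + (-(1 - (1 - σ * u) * (θ * ε))) * B2 + (-(σ * ε * θ)) * c1) := mul_nonneg hf2 hG1.le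
    have p2 : 0 < (1 - σ * u) * ((-(σ * (1 - ε))) * a0 + (-σ) * a1 + (-(σ * (1 - σ * u * (1 - θ * ε)))) * At + (-(1 - (1 - σ * u) * ε)) * B1 + (1 - σ * u) * B2 + (-(σ * ε)) * c1) := mul_pos hk hG2
    linarith only [eM2, p1, p2]
  -- g_S : s₁ B1 + s₂ B2 < a1 + c1
  have hT : ((σ * u + (1 - σ * u) * (1 - ε)) * (θ * ε)) * B1 + ((σ * u + (1 - σ * u) * (1 - θ * ε)) * ε) * B2 < a1 + c1 := by
    have w1 : 0 ≤ (σ * u * (1 - θ * ε) + σ * (θ * ε)) * a1 := mul_nonneg (add_nonneg (mul_nonneg hk0 hθε1) (mul_nonneg hσ.le hθε0.le)) ha1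
    have hεεθ1 : ε * ε * θ ≤ 1 / 10 * (1 / 10) := by
      have h := mul_le_mul hε1 hθε (mul_nonneg hθ.le hε.le) (by norm_num)
      linarith only [h]
    have w2 : 0 ≤ (σ * u * (1 - ε * ε * θ) + σ * (ε * ε * θ)) * c1 :=
      mul_nonneg (add_nonneg (mul_nonneg hk0 (by linarith only [hεεθ1])) (mul_nonneg hσ.le (by positivity))) hc1
    have w3 : 0 ≤ σ * (1 - ε) * (θ * ε) * a0 := mul_nonneg (mul_nonneg (mul_nonneg hσ.le hε0') hθε0.le) ha0
    linarith only [hS, w1, w2, w3]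

  -- name the coefficient polynomials (atoms from here on)
  set C0 := ((1 - σ * u) * (1 - θ * ε) + (1 - (1 - σ * u) * (θ * ε)) * (1 - ε)) with hC0
  set C1 := ((1 - σ * u) + (1 - (1 - σ * u) * (θ * ε))) with hC1
  set CT := ((1 - σ * u) * (θ * (1 - σ * u * (1 - ε))) + (1 - (1 - σ * u) * (θ * ε)) * (1 - σ * u * (1 - θ * ε))) with hCT
  set CC := ((1 - σ * u) * (ε * θ) + (1 - (1 - σ * u) * (θ * ε)) * ε) with hCC
  set D0 := ((1 - (1 - σ * u) * ε) * (1 - θ * ε) + (1 - σ * u) * (1 - ε)) with hD0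
  set D1 := ((1 - (1 - σ * u) * ε) + (1 - σ * u)) with hD1
  set DT := ((1 - (1 - σ * u) * ε) * (θ * (1 - σ * u * (1 - ε))) + (1 - σ * u) * (1 - σ * u * (1 - θ * ε))) with hDT
  set DC := ((1 - (1 - σ * u) * ε) * (ε * θ) + (1 - σ * u) * ε) with hDC
  set Δ := ((1 - σ * u) ^ 2 - (1 - (1 - σ * u) * ε) * (1 - (1 - σ * u) * (θ * ε))) with hΔ
  set S1 := ((σ * u + (1 - σ * u) * (1 - ε)) * (θ * ε)) with hS1
  set S2 := ((σ * u + (1 - σ * u) * (1 - θ * ε)) * ε) with hS2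

  have hR1 : 0 ≤ C0 * a0 + C1 * a1 + CT * At + CC * c1 := by
    have r1 : 0 ≤ C0 * a0 := mul_nonneg hca0p0.le ha0
    have r2 : 0 ≤ C1 * a1 := mul_nonneg hca1p0 ha1
    have r3 : 0 ≤ CT * At := mul_nonneg hcAtp0 hAt
    have r4 : 0 ≤ CC * c1 := mul_nonneg hcc1p hc1
    linarith only [r1, r2, r3, r4]
  have hΔpos : 0 < Δ := by
    have h : 0 < Δ * B1 := by linarith only [hM1, mul_nonneg hσ.le hR1]
    exact (mul_pos_iff_of_pos_right hB1p).1 h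
  -- (5') : from U2, M1'', V :   (1-σu) c₀'' (u B1 + c0 + c1) < Δ' Y
  have h5 : (1 - σ * u) * D0 * (u * B1 + c0 + c1) < Δ * (a0 + c0) := by
    have sa : B2 * (u * B1 + (c0 + c1)) ≤ σ * D * (a0 + a1 + σ * u * (ε * θ * At)) := by linarith only [hU2]
    have d1 : 0 ≤ (D1 - D0) * a1 := mul_nonneg hda20 ha1
    have d2 : 0 ≤ (DT - D0 * (σ * u * (ε * θ))) * At := mul_nonneg (by linarith only [hcmpAt2]) hAt
    have d3 : 0 ≤ DC * c1 := mul_nonneg hcc1pp hc1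
    have sb : D0 * (a0 + a1 + σ * u * (ε * θ * At)) ≤ D0 * a0 + D1 * a1 + DT * At + DC * c1 := by
      linarith only [d1, d2, d3]
    have sc : σ * D * (D0 * (a0 + a1 + σ * u * (ε * θ * At))) ≤ σ * D * (D0 * a0 + D1 * a1 + DT * At + DC * c1) :=
      mul_le_mul_of_nonneg_left sb (mul_nonneg hσ.le hD)
    have sd : D * (σ * (D0 * a0 + D1 * a1 + DT * At + DC * c1)) ≤ D * (Δ * B2) :=
      mul_le_mul_of_nonneg_left hM2.le hD
    have se : D0 * (B2 * (u * B1 + (c0 + c1))) ≤ D0 * (σ * D * (a0 + a1 + σ * u * (ε * θ * At))) :=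
      mul_le_mul_of_nonneg_left sa hca0pp0.le
    have sf : B2 * (D0 * (u * B1 + c0 + c1)) ≤ B2 * (D * Δ) := by linarith only [sc, sd, se]
    have sg : D0 * (u * B1 + c0 + c1) ≤ D * Δ := le_of_mul_le_mul_left sf hB2p
    have sh : (1 - σ * u) * (D0 * (u * B1 + c0 + c1)) ≤ (1 - σ * u) * (D * Δ) := mul_le_mul_of_nonneg_left sg hk.le
    have si : Δ * ((1 - σ * u) * D) < Δ * (a0 + c0) := mul_lt_mul_of_pos_left hDY hΔpos
    linarith only [sh, si]
  -- (5b) : from U1, M1', V :   (1-σu) c₀' (u B2 + c0 + c1) < Δ' Y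
  have h5b : (1 - σ * u) * C0 * (u * B2 + c0 + c1) < Δ * (a0 + c0) := by
    have sa : B1 * (u * B2 + (c0 + c1)) ≤ σ * D * (a0 + a1 + σ * u * (ε * θ * At)) := by linarith only [hU1]
    have d1 : 0 ≤ (C1 - C0) * a1 := mul_nonneg hda10 ha1
    have d2 : 0 ≤ (CT - C0 * (σ * u * (ε * θ))) * At := mul_nonneg (by linarith only [hcmpAt1]) hAt
    have d3 : 0 ≤ CC * c1 := mul_nonneg hcc1p hc1
    have sb : C0 * (a0 + a1 + σ * u * (ε * θ * At)) ≤ C0 * a0 + C1 * a1 + CT * At + CC * c1 := by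
      linarith only [d1, d2, d3]
    have sc : σ * D * (C0 * (a0 + a1 + σ * u * (ε * θ * At))) ≤ σ * D * (C0 * a0 + C1 * a1 + CT * At + CC * c1) :=
      mul_le_mul_of_nonneg_left sb (mul_nonneg hσ.le hD)
    have sd : D * (σ * (C0 * a0 + C1 * a1 + CT * At + CC * c1)) ≤ D * (Δ * B1) :=
      mul_le_mul_of_nonneg_left hM1.le hD
    have se : C0 * (B1 * (u * B2 + (c0 + c1))) ≤ C0 * (σ * D * (a0 + a1 + σ * u * (ε * θ * At))) :=
      mul_le_mul_of_nonneg_left sa hca0p0.le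
    have sf : B1 * (C0 * (u * B2 + c0 + c1)) ≤ B1 * (D * Δ) := by linarith only [sc, sd, se]
    have sg : C0 * (u * B2 + c0 + c1) ≤ D * Δ := le_of_mul_le_mul_left sf hB1p
    have sh : (1 - σ * u) * (C0 * (u * B2 + c0 + c1)) ≤ (1 - σ * u) * (D * Δ) := mul_le_mul_of_nonneg_left sg hk.le
    have si : Δ * ((1 - σ * u) * D) < Δ * (a0 + c0) := mul_lt_mul_of_pos_left hDY hΔpos
    linarith only [sh, si]
  -- (6) : a0-bound from M1' (drop the At term)
  have h6 : σ * C0 * a0 + σ * (C1 * a1 + CC * c1) < Δ * B1 := by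
    have r3 : 0 ≤ σ * (CT * At) := mul_nonneg hσ.le (mul_nonneg hcAtp0 hAt)
    linarith only [hM1, r3]

  -- final: σ c₀' (W − Δ') Y < W B1 (Δ' − σu c₀') ≤ 0
  have f1 : σ * C0 * ((1 - σ * u) * D0 * (u * B1 + c0 + c1)) < σ * C0 * (Δ * (a0 + c0)) :=
    mul_lt_mul_of_pos_left h5 (mul_pos hσ hca0p0)
  have f2 : (1 - σ * u) * D0 * (σ * C0 * a0 + σ * (C1 * a1 + CC * c1)) < (1 - σ * u) * D0 * (Δ * B1) :=
    mul_lt_mul_of_pos_left h6 hWpos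
  have f3 : 0 ≤ (1 - σ * u) * D0 * (σ * (C1 * a1 + CC * c1)) :=
    mul_nonneg hWpos.le (mul_nonneg hσ.le (add_nonneg (mul_nonneg hca1p0 ha1) (mul_nonneg hcc1p hc1)))
  have f4 : 0 ≤ σ * C0 * ((1 - σ * u) * D0) * c1 := mul_nonneg (mul_nonneg (mul_pos hσ hca0p0).le hWpos.le) hc1
  have f5 : (1 - σ * u) * D0 * (Δ * B1) ≤ (1 - σ * u) * D0 * ((σ * u * C0) * B1) :=
    mul_le_mul_of_nonneg_left (mul_le_mul_of_nonneg_right hcp hB1) hWpos.le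
  have f6 : 0 < σ * C0 * ((1 - σ * u) * D0 - Δ) * (a0 + c0) := mul_pos (mul_pos (mul_pos hσ hca0p0) hWΔ) hY
  linarith only [f1, f2, f3, f4, f5, f6]

end Gate3

end Quant

end Summit.CriticalPhenomena.PercolationContinuityZ3.Theorems
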